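import Summits.ResolutionOfSingularities.ResolutionOfSingularities.Theorems.DeltaCutStellarStrategyAbstract
import Summits.ResolutionOfSingularities.ResolutionOfSingularities.Theorems.DeltaCutStellarTame

/-!
# StellarCut T10 — «HypShape»: the TAME HYPERSURFACE SHAPE `(hⁿ + u·m)` as a `Shape` for the abstract face strategy —
# the predicate, its FACE and TERMINAL lemmas, and the marking-`1` case (lens-6, g33; 0-weight)

`DeltaCutStellarStrategyAbstract` (T9) runs Kollár's terminating face strategy for every FACE-STABLE shape
`P : Shape` (`FaceStableShape n P`: a ROUND lemma, a FACE lemma, a TERMINAL lemma).  This file types the shape of the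
TAME hypersurface cell `WORNCHypTame n` of `DeltaCutStellarTame` (T8) at LIST LEVEL (a labelled boundary
`E : List (IdealSheafData × ℕ)` with a contact member `H`, as in T4–T6):

* `ncHypShape n X E H M` — the marking is `n`; `n` is a UNIT in every stalk of `X` (the list-level trace of
  `CharP k p ∧ ¬ p ∣ n` over a base field, `isUnit_natCast_stalk_of_not_dvd`; it is what the derivation guard of
  `DeltaCutStellarGuard` consumes and it persists under blow-ups); the entries of `E` equal to `H` carry the label `0`
  (unless `V(H) = ∅`); at every point `x ∈ V(H)` the stalk of the ideal is PRINCIPAL, `𝓘_x = (hⁿ + u·m)` with `u` a unit,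
  `(h) = H_x`, `(m) = 𝓜(E)_x` (tree `NCFrame.HypShape`, verbatim); and `supp(𝓘, n) ⊆ V(H)` (tree `NCFrame.SuppLE`).
* the FACE lemma `support_finsetSup_subset_support_ncHypShape` (a face through `H` of weight `≥ n` lies in the support) and
  the TERMINAL lemma `support_ncHypShape_eq_empty` (weight `< n` along `V(H)` ⇒ empty support), both from the pointwise
  criterion `ncHypShape.mem_support_iff_weightAt`: at `x ∈ V(H)`, `x ∈ supp ⟺ 𝓜(E)_x ⊆ 𝔪_xⁿ ⟺ n ≤ weightAt E x`
  (`hⁿ ∈ 𝔪ⁿ`, `u` a unit; Literature `le_idealOrder_monomialIdeal_iff`).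
* the MARKING-`1` case `support_ncHypShape_one_eq_empty`: a `ncHypShape 1`-datum has EMPTY support — `supp(𝓘, 1) = V(𝓘) ⊆ V(H)`
  forces `H ⊆ √𝓘` (Mathlib's Galois connection `support ⊣ vanishingIdeal`), and in the regular local ring `𝒪_x` a power
  `hᴺ ∈ (h + u·m)` with `m` a monomial in the OTHER parameters forces `h + u·m` to be a unit (`isUnit_of_add_dvd_pow`).
* the BRIDGE `ncHypShape_of_isNCHypStage`: a base `n`-datum over a field of characteristic `p ∤ n` whose stage is a
  hypersurface-shape labelled n.c. stage (`IsNCHypStage n`, T1) is a `ncHypShape n`-datum for the list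
  `E := (𝓘(H), 0) :: [(𝓘(Dᵢ), aᵢ)]ᵢ` of T6 (`NCFrame.expList`), with `H :: boundaryOf E` s.n.c. and `H ∈ boundaryOf E`.

The ROUND lemma (persistence of the shape under the blow-up of a face through `H` of weight `≥ n`, for `n ≥ 2`) is
`DeltaCutStellarHypPersist` + `DeltaCutStellarHypFibre`; the law `worNCHypTame_holds` is assembled in `DeltaCutStellarHypTame`.
TAME desk inhabitant: `x³ + (1 + xz)·z³w³` in characteristic `2`, `n = 3` (T8).  0 sorry; axioms standard. [new] [folklore]
[cite: Kollar2007, (3.111) Step 3] [cite: BierstoneGrigorievMilmanWlodarczyk2011, §4 Step 2b]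
-/

noncomputable section

open CategoryTheory CategoryTheory.Limits AlgebraicGeometry TopologicalSpace IsLocalRing
open Literature.AlgebraicGeometry.Resolution

namespace Summit.ResolutionOfSingularities.ResolutionOfSingularities.Theorems.DeltaCutClasses

open Summit.ResolutionOfSingularities.ResolutionOfSingularities.Theorems
open WeakOrderReduction ForcedTowerClasses

/-! ### §Shape — the tame hypersurface shape at list level -/

/-- **THE TAME HYPERSURFACE SHAPE `ncHypShape n`** (a `Shape` for `FaceStableShape`): marking `n`; `n` a unit in every
stalk; the `H`-entries of `E` have label `0` (or `V(H) = ∅`); at every `x ∈ V(H)` the stalk ideal is `(hⁿ + u·m)`, `u` a unit,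
`(h) = H_x`, `(m) = 𝓜(E)_x` (`NCFrame.HypShape`, list level); `supp(M) ⊆ V(H)` (`NCFrame.SuppLE`). -/
def ncHypShape (n : ℕ) : Shape := fun X E H M =>
  M.mult = n ∧ (∀ x : X, IsUnit ((n : ℕ) : X.presheaf.stalk x)) ∧
    (∀ q ∈ E, q.1 = H → q.2 = 0 ∨ (H.support : Set X) = ∅) ∧
    (∀ x : X, x ∈ H.support → ∃ h m u : X.presheaf.stalk x, IsUnit u ∧ stalkIdeal H x = Ideal.span {h} ∧
      stalkIdeal (monomialIdeal E) x = Ideal.span {m} ∧ stalkIdeal M.ideal x = Ideal.span {h ^ n + u * m}) ∧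
    M.support ⊆ (H.support : Set X)

/-! ### §Local — two lines of local algebra for `hⁿ + u·m` -/

section LocalAlgebra

variable {R : Type*} [CommRing R] [IsLocalRing R]

/-- `hⁿ + u·m ∈ 𝔪ⁿ` with `h ∈ 𝔪` and `u` a unit forces `m ∈ 𝔪ⁿ`. [folklore] -/
theorem mem_pow_of_pow_add_unit_mul_mem {h m u : R} (hu : IsUnit u) (hh : h ∈ maximalIdeal R) {n : ℕ}
    (hf : h ^ n + u * m ∈ maximalIdeal R ^ n) : m ∈ maximalIdeal R ^ n := by
  have h1 : u * m ∈ maximalIdeal R ^ n := by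
    have := Ideal.sub_mem _ hf (Ideal.pow_mem_pow hh n)
    rwa [add_sub_cancel_left] at this
  obtain ⟨v, rfl⟩ := hu
  have : m = (↑v⁻¹ : R) * (↑v * m) := by rw [← mul_assoc, Units.inv_mul, one_mul]
  rw [this]
  exact Ideal.mul_mem_left _ _ h1

/-- `m ∈ 𝔪ⁿ` and `h ∈ 𝔪` give `hⁿ + u·m ∈ 𝔪ⁿ`. [folklore] -/
theorem pow_add_mul_mem_pow {h m : R} (u : R) (hh : h ∈ maximalIdeal R) {n : ℕ} (hm : m ∈ maximalIdeal R ^ n) :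
    h ^ n + u * m ∈ maximalIdeal R ^ n :=
  Ideal.add_mem _ (Ideal.pow_mem_pow hh n) (Ideal.mul_mem_left _ u hm)

/-- **Radical rigidity of `h + g`**: in a domain, if `h` is prime, `h ∤ g` and `h + g` divides some power `hᴺ`, then `h + g`
is a unit (cancel `h` and induct on `N`). [folklore] -/
theorem isUnit_of_add_dvd_pow {S : Type*} [CommRing S] [IsDomain S] {h g : S} (hp : Prime h) (hg : ¬ h ∣ g) :
    ∀ {N : ℕ}, h + g ∣ h ^ N → IsUnit (h + g)
  | 0, hN => isUnit_of_dvd_one (by rwa [pow_zero] at hN)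
  | N + 1, hN => by
    obtain ⟨t, ht⟩ := hN
    -- `(h + g)·t = h^{N+1}` ⇒ `h ∣ g t` ⇒ `h ∣ t`
    have hgt : h ∣ g * t := by
      refine ⟨h ^ N - t, ?_⟩
      have : g * t = h ^ (N + 1) - h * t := by rw [ht]; ring
      rw [this]; ring
    obtain ⟨t₁, rfl⟩ := (hp.dvd_or_dvd hgt).resolve_left hg
    refine isUnit_of_add_dvd_pow hp hg (N := N) ⟨t₁, mul_left_cancel₀ hp.ne_zero ?_⟩
    rw [← pow_succ', ht]; ring

end LocalAlgebra

/-! ### §Support — the pointwise support criterion, FACE and TERMINAL lemmas -/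

section SupportLaw

variable {X : Scheme.{0}} {E : List (X.IdealSheafData × ℕ)} {H : X.IdealSheafData} {n : ℕ} {M : MarkedIdeal X}

/-- a stalk generator of `H` at a point of `V(H)` lies in the maximal ideal -/
theorem mem_maximalIdeal_of_stalkIdeal_eq_span {x : X} (hx : x ∈ H.support) {h : X.presheaf.stalk x}
    (hh : stalkIdeal H x = Ideal.span {h}) : h ∈ maximalIdeal (X.presheaf.stalk x) := by
  have := (mem_support_iff_stalkIdeal_le H x).mp hx
  rw [hh, Ideal.span_singleton_le_iff_mem] at this
  exact this

namespace ncHypShape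

/-- the marking of a `ncHypShape n`-datum is `n` -/
theorem mult_eq (hP : ncHypShape n X E H M) : M.mult = n := hP.1

/-- `n` is a unit in every stalk -/
theorem isUnit_natCast (hP : ncHypShape n X E H M) (x : X) : IsUnit ((n : ℕ) : X.presheaf.stalk x) := hP.2.1 x

/-- the `H`-entries of `E` carry the label `0` (or `V(H) = ∅`) -/
theorem label_eq_zero (hP : ncHypShape n X E H M) {q : X.IdealSheafData × ℕ} (hq : q ∈ E) (hqH : q.1 = H) :
    q.2 = 0 ∨ (H.support : Set X) = ∅ := hP.2.2.1 q hq hqH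

/-- the hypersurface presentation at a point of `V(H)` -/
theorem exists_generator (hP : ncHypShape n X E H M) {x : X} (hx : x ∈ H.support) :
    ∃ h m u : X.presheaf.stalk x, IsUnit u ∧ stalkIdeal H x = Ideal.span {h} ∧
      stalkIdeal (monomialIdeal E) x = Ideal.span {m} ∧ stalkIdeal M.ideal x = Ideal.span {h ^ n + u * m} :=
  hP.2.2.2.1 x hx

/-- `supp(M) ⊆ V(H)` -/
theorem support_subset (hP : ncHypShape n X E H M) : M.support ⊆ (H.support : Set X) := hP.2.2.2.2

/-- **AT A POINT OF `V(H)`: `x ∈ supp(M) ⟺ 𝓜(E)_x ⊆ 𝔪_xⁿ`** (`hⁿ ∈ 𝔪ⁿ`, `u` a unit). [folklore] -/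
theorem mem_support_iff (hP : ncHypShape n X E H M) {x : X} (hx : x ∈ H.support) :
    x ∈ M.support ↔ stalkIdeal (monomialIdeal E) x ≤ maximalIdeal (X.presheaf.stalk x) ^ n := by
  obtain ⟨h, m, u, hu, hHx, hMx, hIx⟩ := hP.exists_generator hx
  rw [MarkedIdeal.mem_support_iff, hP.mult_eq, hIx, hMx, Ideal.span_singleton_le_iff_mem,
    Ideal.span_singleton_le_iff_mem]
  have hh := mem_maximalIdeal_of_stalkIdeal_eq_span hx hHx
  exact ⟨mem_pow_of_pow_add_unit_mul_mem hu hh, pow_add_mul_mem_pow u hh⟩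

/-- **AT A POINT OF `V(H)`: `x ∈ supp(M) ⟺ n ≤ weightAt E x`** (the boundary of `E` being s.n.c.).
[cite: BierstoneGrigorievMilmanWlodarczyk2011, §4 Step 2b] -/
theorem mem_support_iff_weightAt (hE : HasSNC (boundaryOf E)) (hP : ncHypShape n X E H M) {x : X}
    (hx : x ∈ H.support) : x ∈ M.support ↔ n ≤ weightAt E x := by
  rw [hP.mem_support_iff hx, ← le_idealOrder_monomialIdeal_iff hE n x, le_idealOrder_iff]

end ncHypShape

/-- **FACE LEMMA: a face through `H` of weight `≥ n` lies in the support of a `ncHypShape n`-datum** (first clause of weak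
admissibility). [cite: Kollar2007, (3.111) Step 3] -/
theorem support_finsetSup_subset_support_ncHypShape (hEs : HasSNC (H :: boundaryOf E)) {T : Finset X.IdealSheafData}
    (hHT : H ∈ T) (hmT : n ≤ weightOf E T) (hP : ncHypShape n X E H M) :
    ((T.sup id).support : Set X) ⊆ M.support := by
  intro x hx
  have hxH : x ∈ H.support := (mem_support_finsetSup_iff T x).mp hx H hHT
  rw [hP.mem_support_iff hxH]
  have hE' : HasSNC (boundaryOf ((H, 0) :: E)) := hEs
  have hn' : n ≤ weightOf ((H, 0) :: E) T := by rwa [weightOf_cons_zero]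
  have hmem := support_finsetSup_subset_support_monomialMarked hE' hn' hx
  rwa [MarkedIdeal.mem_support_iff, monomialMarked_ideal, monomialMarked_mult, monomialIdeal_cons_zero] at hmem

/-- **TERMINAL LEMMA: if every point of `V(H)` has boundary weight `< n`, a `ncHypShape n`-datum has empty support**
(`supp ⊆ V(H)` and the pointwise criterion). [cite: Kollar2007, (3.111) Step 3] -/
theorem support_ncHypShape_eq_empty (hE : HasSNC (boundaryOf E)) (hP : ncHypShape n X E H M)
    (h : ∀ x ∈ H.support, weightAt E x < n) : M.support = ∅ := by
  ext x
  simp only [Set.mem_empty_iff_false, iff_false]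
  intro hx
  have hxH : x ∈ H.support := hP.support_subset hx
  exact absurd (h x hxH) (not_lt.mpr ((hP.mem_support_iff_weightAt hE hxH).mp hx))

end SupportLaw

/-! ### §One — the marking-`1` case: the support is empty -/

section MarkingOne

variable {X : Scheme.{0}} {E : List (X.IdealSheafData × ℕ)} {H : X.IdealSheafData} {M : MarkedIdeal X}

/-- labelled rsop-part data of an s.n.c. list at a point (the point clause of `HasSNC`, re-packaged as `IsRsopPart`).
[cite: BierstoneGrigorievMilmanWlodarczyk2011, Def. 3.1.1] -/
theorem exists_isRsopPart_labels_of_hasSNC {Es : List X.IdealSheafData} (hEs : HasSNC Es) (x : X) :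
    ∃ (d : ℕ) (z : Fin d → X.presheaf.stalk x), IsRsopPart z ∧
      ∃ ι : {D : X.IdealSheafData // D ∈ Es ∧ x ∈ D.support} → Fin d,
        Function.Injective ι ∧ ∀ D, stalkIdeal D.1 x = Ideal.span {z (ι D)} := by
  obtain ⟨hreg, z, hz, hE, -⟩ := hEs x
  haveI := hreg
  refine ⟨_, z, ?_, hE⟩
  simpa using isRsopPart_comp_of_rsop rfl z hz id Function.injective_id

/-- **The monomial of `E` at a point avoids the contact parameter**: under `HasSNC (H :: boundaryOf E)`, at `x ∈ V(H)` with the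
`H`-entries of `E` labelled `0`, stalk generators `(h) = H_x`, `(m) = 𝓜(E)_x` satisfy: `h` is prime and `h ∤ m` (the stalk of
`𝓜(E)` is a product of powers of the OTHER parameters of the labelled regular system). [folklore] -/
theorem prime_and_not_dvd_of_labels (hEs : HasSNC (H :: boundaryOf E)) {x : X} (hx : x ∈ H.support)
    (hlab : ∀ q ∈ E, q.1 = H → q.2 = 0) {h m : X.presheaf.stalk x} (hh : stalkIdeal H x = Ideal.span {h})
    (hm : stalkIdeal (monomialIdeal E) x = Ideal.span {m}) : Prime h ∧ ¬ h ∣ m := by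
  obtain ⟨d, z, hz, ι, hιinj, hι⟩ := exists_isRsopPart_labels_of_hasSNC hEs x
  haveI := hz.isRegularLocalRing
  haveI := isDomain_of_isRegularLocalRing (X.presheaf.stalk x)
  set iH : Fin d := ι ⟨H, List.mem_cons_self, hx⟩ with hiH
  have hHz : stalkIdeal H x = Ideal.span {z iH} := hι ⟨H, List.mem_cons_self, hx⟩
  have hassoc : Associated h (z iH) := Ideal.span_singleton_eq_span_singleton.mp (hh.symm.trans hHz)
  have hP : (Ideal.span {z iH}).IsPrime := (Ideal.span_singleton_prime (hz.ne_zero iH)).mpr (hz.prime iH)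
  refine ⟨hassoc.symm.prime_iff.mp (hz.prime iH), fun hdvd => ?_⟩
  replace hdvd : Ideal.span {m} ≤ Ideal.span {z iH} :=
    Ideal.span_singleton_le_span_singleton.mpr (hassoc.dvd_iff_dvd_left.mp hdvd)
  rw [← hm, stalkIdeal_monomialIdeal] at hdvd
  -- no product of powers of stalks of entries of `E` lies inside the prime `(z iH)`
  suffices hprod : ∀ E₀ : List (X.IdealSheafData × ℕ), (∀ q ∈ E₀, q ∈ E) →
      ¬ (E₀.map fun p => stalkIdeal p.1 x ^ p.2).prod ≤ Ideal.span {z iH} from hprod E (fun _ hq => hq) hdvd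
  intro E₀ hE₀
  induction E₀ with
  | nil =>
    intro hle
    rw [List.map_nil, List.prod_nil, Ideal.one_eq_top, top_le_iff] at hle
    exact hP.ne_top hle
  | cons q E₀ ih =>
    rw [List.map_cons, List.prod_cons]
    intro hle
    rcases hP.mul_le.mp hle with h1 | h2
    · have hq : q ∈ E := hE₀ q List.mem_cons_self
      by_cases hxq : x ∈ q.1.support
      · have hqE : q.1 ∈ H :: boundaryOf E := List.mem_cons_of_mem _ (fst_mem_boundaryOf hq)
        rw [hι ⟨q.1, hqE, hxq⟩, Ideal.span_singleton_pow, Ideal.span_singleton_le_span_singleton] at h1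
        -- `z iH ∣ z (ι q.1) ^ q.2`: then `q.2 ≠ 0` and `ι q.1 = iH`, i.e. `q.1 = H` — whose label is `0`
        by_cases hq2 : q.2 = 0
        · rw [hq2, pow_zero] at h1
          exact (hz.prime iH).not_unit (isUnit_of_dvd_one h1)
        · have heq : ι ⟨q.1, hqE, hxq⟩ = iH := by
            by_contra hne
            exact hz.not_dvd (Ne.symm hne) ((hz.prime iH).dvd_of_dvd_pow h1)
          have hq1 : q.1 = H := congrArg (fun D => D.1) (hιinj (heq.trans hiH))
          exact hq2 (hlab q hq hq1)
      · rw [stalkIdeal_eq_top_of_not_mem_support hxq, Ideal.top_pow, top_le_iff] at h1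
        exact hP.ne_top h1
    · exact ih (fun q' hq' => hE₀ q' (List.mem_cons_of_mem _ hq')) h2

/-- **MARKING `1`: a `ncHypShape 1`-datum has EMPTY support.**  At `x ∈ supp(𝓘, 1) ⊆ V(H)`: `supp(𝓘, 1) = V(𝓘)`, so
`H ⊆ I(V(𝓘)) = √𝓘` (Mathlib `le_support_iff_le_vanishingIdeal`, `vanishingIdeal_support`), whence `h + u·m ∣ hᴺ` in `𝒪_x`;
with `h ∤ u·m` (`prime_and_not_dvd_of_labels`) this makes `h + u·m` a unit (`isUnit_of_add_dvd_pow`), contradicting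
`𝓘_x ⊆ 𝔪_x`. [folklore] -/
theorem support_ncHypShape_one_eq_empty (hEs : HasSNC (H :: boundaryOf E)) (hP : ncHypShape 1 X E H M) :
    M.support = ∅ := by
  ext x
  simp only [Set.mem_empty_iff_false, iff_false]
  intro hx
  have hxH : x ∈ H.support := hP.support_subset hx
  have hne : (H.support : Set X) ≠ ∅ := Set.nonempty_iff_ne_empty.mp ⟨x, hxH⟩
  have hlab : ∀ q ∈ E, q.1 = H → q.2 = 0 := fun q hq hqH => (hP.label_eq_zero hq hqH).resolve_right hne
  obtain ⟨h, m, u, hu, hHx, hMx, hIx⟩ := hP.exists_generator hxH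
  haveI := (hEs x).1
  haveI := isDomain_of_isRegularLocalRing (X.presheaf.stalk x)
  obtain ⟨hprime, hmh⟩ := prime_and_not_dvd_of_labels hEs hxH hlab hHx hMx
  have hum : ¬ h ∣ u * m := fun h1 => hmh (hu.dvd_mul_left.mp h1)
  -- `supp(M) = V(M.ideal) ⊆ V(H)` gives `H ≤ √(M.ideal)`
  have hsupp : M.support = (M.ideal.support : Set X) := MarkedIdeal.support_of_mult_eq_one M hP.mult_eq
  have hle : M.ideal.support ≤ H.support := by
    intro y hy
    exact hP.support_subset (hsupp ▸ hy)
  have hrad : H ≤ M.ideal.radical := by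
    rw [← Scheme.IdealSheafData.vanishingIdeal_support]
    exact Scheme.IdealSheafData.le_support_iff_le_vanishingIdeal.mp hle
  have hhrad : h ∈ (stalkIdeal M.ideal x).radical := by
    rw [← stalkIdeal_radical]
    exact stalkIdeal_mono hrad x (hHx ▸ Ideal.mem_span_singleton_self h)
  rw [hIx, pow_one] at hhrad
  obtain ⟨N, hN⟩ := hhrad
  have hunit : IsUnit (h + u * m) := isUnit_of_add_dvd_pow hprime hum (Ideal.mem_span_singleton.mp hN)
  -- but `𝓘_x = (h + u m) ⊆ 𝔪_x`
  have hmem : stalkIdeal M.ideal x ≤ maximalIdeal _ := by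
    have := (MarkedIdeal.mem_support_iff M x).mp hx
    rwa [hP.mult_eq, pow_one] at this
  rw [hIx, pow_one, Ideal.span_singleton_le_iff_mem] at hmem
  exact (maximalIdeal.isMaximal _).ne_top (Ideal.eq_top_of_isUnit_mem _ hmem hunit)

end MarkingOne

/-! ### §Bridge — from the tree's `IsNCHypStage` over a base field of characteristic `p ∤ n` to `ncHypShape n` -/

section Bridge

open Scheme.IdealSheafData (vanishingIdeal)

/-- **`n` is a unit in every stalk of a scheme over a field `k` of characteristic `p ∤ n`**: `(n : k) ≠ 0`
(`CharP.cast_eq_zero_iff`) and the structure maps `k → Γ(Y, 𝒪_Y) → 𝒪_{Y,y}` are ring homomorphisms.  This is the ONLY use of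
`CharP k p ∧ ¬ p ∣ n` in the tame law. [folklore] -/
theorem isUnit_natCast_stalk_of_not_dvd {p : ℕ} {k : Type} [Field k] [CharP k p] {Y : Scheme.{0}} (g : Y ⟶ Spec (.of k))
    {n : ℕ} (hpn : ¬ p ∣ n) (y : Y) : IsUnit ((n : ℕ) : Y.presheaf.stalk y) := by
  have hk : IsUnit ((n : ℕ) : k) := by
    rw [isUnit_iff_ne_zero, Ne, CharP.cast_eq_zero_iff k p n]
    exact hpn
  let φ : k →+* (Y.presheaf.stalk y : Type _) :=
    (Y.presheaf.germ ⊤ y trivial).hom.comp (g.appTop.hom.comp (Scheme.ΓSpecIso (.of k)).inv.hom)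
  simpa only [map_natCast] using hk.map φ

variable {Y : Scheme.{0}}

/-- membership in the support of a vanishing ideal sheaf is membership in the closed set (Mathlib, re-stated pointwise) -/
theorem mem_support_vanishingIdeal_iff {Z : Closeds Y} {y : Y} : y ∈ (vanishingIdeal Z).support ↔ y ∈ (Z : Set Y) := by
  rw [← SetLike.mem_coe, Scheme.IdealSheafData.coe_support_vanishingIdeal]

/-- **THE BRIDGE.**  For an `n`-marked ideal `M` on a regular Noetherian scheme in whose stalks `n` is a unit, an s.n.c. frame
`F` on the stage `(Y, M.ideal)` in the HYPERSURFACE SHAPE with `SuppLE` (`IsNCHypStage n`, T1) yields the list-level shape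
`ncHypShape n Y E 𝓘(H) M` for `E := (𝓘(H), 0) :: [(𝓘(Dᵢ), aᵢ)]ᵢ` (T6 `NCFrame.expList`), together with `𝓘(H) ∈ boundaryOf E` and
`HasSNC (𝓘(H) :: boundaryOf E)` (T6 `IsSNC.hasSNC_of_forall_mem`).  The label clause holds because the only `𝓘(H)`-entry of `E` is
the head (an equality `𝓘(Dᵢ) = 𝓘(H)` would give `Dᵢ = H`, excluded by `IsSNC`); the `SuppLE` clause is the tree's, read through
`le_idealOrder_iff`. [new] [folklore] -/
theorem ncHypShape_of_frame [IsNoetherian Y] (hY : Scheme.IsRegular Y) {n : ℕ} {M : MarkedIdeal Y} (hμ : M.mult = n)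
    (hunit : ∀ y : Y, IsUnit ((n : ℕ) : Y.presheaf.stalk y)) {F : NCFrame ⟨Y, M.ideal⟩} (hS : F.IsSNC) (hF : F.HypShape n)
    (hSupp : F.SuppLE n) :
    vanishingIdeal F.H ∈ boundaryOf ((vanishingIdeal F.H, 0) :: F.expList) ∧
      HasSNC (vanishingIdeal F.H :: boundaryOf ((vanishingIdeal F.H, 0) :: F.expList)) ∧
      ncHypShape n Y ((vanishingIdeal F.H, 0) :: F.expList) (vanishingIdeal F.H) M := by
  refine ⟨List.mem_cons_self, hS.hasSNC_of_forall_mem hY fun K hK => ?_, hμ, hunit, ?_, ?_, ?_⟩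
  · have hK : K = vanishingIdeal F.H ∨ K ∈ boundaryOf F.expList := by
      simpa only [List.map_cons, List.mem_cons, or_self_left] using hK
    rcases hK with rfl | hK
    · exact ⟨none, rfl⟩
    · obtain ⟨i, rfl⟩ := F.mem_boundaryOf_expList_iff.mp hK
      exact ⟨some i, rfl⟩
  · -- the label clause: the head carries `0`; no `𝓘(Dᵢ)` equals `𝓘(H)`
    intro q hq hqH
    rcases List.mem_cons.mp hq with rfl | hq
    · exact Or.inl rfl
    · exfalso
      have hq1 : q.1 ∈ boundaryOf F.expList := fst_mem_boundaryOf hq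
      obtain ⟨i, hi⟩ := F.mem_boundaryOf_expList_iff.mp hq1
      have hset : ((F.D i : Closeds Y) : Set Y) = (F.H : Set Y) := by
        rw [← Scheme.IdealSheafData.coe_support_vanishingIdeal (Z := F.D i), ← hi, hqH,
          Scheme.IdealSheafData.coe_support_vanishingIdeal]
      exact hS.2.2.2.2.1 i hset.le
  · -- the hypersurface presentation along `V(𝓘(H)) = H`
    intro x hx
    obtain ⟨h, m, u, hu, hh, hm, hI⟩ := hF x (mem_support_vanishingIdeal_iff.mp hx)
    refine ⟨h, m, u, hu, hh, ?_, hI⟩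
    rw [monomialIdeal_cons_zero, NCFrame.monomialIdeal_expList]
    exact hm
  · -- `supp(M) ⊆ V(𝓘(H))`
    intro x hx
    rw [SetLike.mem_coe, mem_support_vanishingIdeal_iff]
    refine hSupp x ((le_idealOrder_iff M.ideal x n).mpr ?_)
    have := (MarkedIdeal.mem_support_iff M x).mp hx
    rwa [hμ] at this

/-- **THE BRIDGE from the binders of `WORNCHypTame n`**: a base `n`-datum over a field of characteristic `p ∤ n` whose stage is a
hypersurface-shape labelled n.c. stage is, for some list `E` and contact member `H` with `HasSNC (H :: boundaryOf E)` and
`H ∈ boundaryOf E`, a `ncHypShape n`-datum. [new] [folklore] -/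
theorem exists_ncHypShape_of_isNCHypStage {p : ℕ} {k : Type} [Field k] [CharP k p] (g : Y ⟶ Spec (.of k)) (hB : IsBase Y g)
    {n : ℕ} (hpn : ¬ p ∣ n) {M : MarkedIdeal Y} (hM : IsDatum n M) (hNC : IsNCHypStage n ⟨Y, M.ideal⟩) :
    ∃ (E : List (Y.IdealSheafData × ℕ)) (H : Y.IdealSheafData),
      HasSNC (H :: boundaryOf E) ∧ H ∈ boundaryOf E ∧ ncHypShape n Y E H M := by
  haveI := hB.locallyOfFiniteType
  haveI := hB.quasiCompact
  haveI : IsLocallyNoetherian Y := LocallyOfFiniteType.isLocallyNoetherian g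
  haveI : CompactSpace Y := QuasiCompact.compactSpace_of_compactSpace g
  haveI : IsNoetherian Y := {}
  obtain ⟨F, hS, hF, hSupp⟩ := hNC
  obtain ⟨hH, hEs, hP⟩ :=
    ncHypShape_of_frame hB.isRegular hM.1 (isUnit_natCast_stalk_of_not_dvd g hpn) hS hF hSupp
  exact ⟨_, _, hEs, hH, hP⟩

end Bridge

end Summit.ResolutionOfSingularities.ResolutionOfSingularities.Theorems.DeltaCutClasses
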